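import Mathlib

/-!
# Line `Sketch` (crux `DyadicWallCascade.HalfSpaceHierarchy`, stmt-AnomalousDissipation-18627):
# tool stub `stub_subCriticalMatchingNotSurjective` — sub-critical matching is not solvable

The idea card `octave-transfer-rpf` linearises the self-similar matching of the crux as
`M = A − w • K`, where `K` (the Koopman operator of a `4:1` expanding map) is an isometric
embedding whose range is a proper subspace.  This file proves the abstract
"sub-critical ⇒ not solvable" half of the resulting dichotomy; it is pure functional analysis
over Mathlib (no fluid content).

**Statement.** Let `X` be a real Banach space, `K : X →L[ℝ] X` with `‖K x‖ = ‖x‖` for all `x`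
and `K` not surjective, `A : X →L[ℝ] X`, and `0 < w` with `‖A‖ < w`.  Then `A − w • K` is not
surjective.

**Proof (elementary continuity method, no Fredholm theory).** Put `c := w − ‖A‖ > 0` and
`T t := t • A − w • K`.  For `0 ≤ t ≤ 1` every `T t` is bounded below,
`c‖x‖ ≤ ‖T t x‖`, so a surjective `T t` is bijective, hence (open mapping theorem,
`ContinuousLinearMap.isUnit_iff_bijective`) a unit of the Banach algebra `X →L[ℝ] X` whose
inverse has norm `≤ c⁻¹`.  If `T t` is a unit `u` and `|s − t| * ‖A‖ < c`, then
`T s = u * (1 + u⁻¹ * (T s − T t))` with `‖u⁻¹ * (T s − T t)‖ ≤ c⁻¹ * |s − t| * ‖A‖ < 1`, so `T s`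
is a unit by the Neumann series (`isUnit_one_sub_of_norm_lt_one`).  Choosing `N : ℕ` with
`‖A‖ / c < N` and stepping `t = 1, 1 − 1/N, …, 0`, surjectivity of `T 1 = A − w • K` would make
`T 0 = −(w • K)` a unit, whence `K` surjective (as `w ≠ 0`) — a contradiction.

Source: folklore (stability of the semi-Fredholm index in its weakest form); for context see
T. Kato, *Perturbation Theory for Linear Operators*, Ch. IV §5.17 and §5.22; card
`octave-transfer-rpf`.
-/

set_option linter.dupNamespace false

namespace Summit.AnomalousDissipation.AnomalousDissipation.Theorems.HalfSpaceHierarchy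

/-- Neumann-series perturbation step in a complete normed ring: if `u` is a unit with
`‖u⁻¹‖ ≤ c⁻¹` and `‖v − u‖ < c`, then `v` is a unit. -/
private theorem subCritical_isUnit_of_norm_sub_lt {R : Type*} [NormedRing R] [CompleteSpace R]
    (u : Rˣ) {v : R} {c : ℝ} (hc : 0 < c) (hu : ‖(↑u⁻¹ : R)‖ ≤ c⁻¹) (hv : ‖v - ↑u‖ < c) :
    IsUnit v := by
  have h : ‖(↑u⁻¹ : R) * (v - ↑u)‖ < 1 := by
    calc ‖(↑u⁻¹ : R) * (v - ↑u)‖ ≤ ‖(↑u⁻¹ : R)‖ * ‖v - ↑u‖ := norm_mul_le _ _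
      _ ≤ c⁻¹ * ‖v - ↑u‖ := by gcongr
      _ < c⁻¹ * c := by gcongr
      _ = 1 := inv_mul_cancel₀ hc.ne'
  have hunit : IsUnit (1 - -((↑u⁻¹ : R) * (v - ↑u))) :=
    isUnit_one_sub_of_norm_lt_one (by rwa [norm_neg])
  have hv_eq : v = ↑u * (1 - -((↑u⁻¹ : R) * (v - ↑u))) := by
    rw [sub_neg_eq_add, mul_add, mul_one, ← mul_assoc, Units.mul_inv, one_mul, add_sub_cancel]
  rw [hv_eq]
  exact (Units.isUnit u).mul hunit

variable {X : Type*} [NormedAddCommGroup X] [NormedSpace ℝ X]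

/-- Lower bound: for an isometric embedding `K` and `0 ≤ t ≤ 1`, the operator `t • A − w • K`
is bounded below by `w − ‖A‖`. -/
private theorem subCritical_lower_bound (K A : X →L[ℝ] X) (w t : ℝ)
    (hK : ∀ x : X, ‖K x‖ = ‖x‖) (ht0 : 0 ≤ t) (ht1 : t ≤ 1) (x : X) :
    (w - ‖A‖) * ‖x‖ ≤ ‖(t • A - w • K) x‖ := by
  have h1 : ‖(t • A - w • K) x‖ = ‖t • A x - w • K x‖ := by simp
  have h2 : ‖w • K x‖ - ‖t • A x‖ ≤ ‖t • A x - w • K x‖ := by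
    rw [norm_sub_rev]; exact norm_sub_norm_le _ _
  have h3 : ‖w • K x‖ = |w| * ‖x‖ := by rw [norm_smul, hK, Real.norm_eq_abs]
  have h4 : ‖t • A x‖ ≤ ‖A‖ * ‖x‖ := by
    rw [norm_smul, Real.norm_eq_abs, abs_of_nonneg ht0]
    calc t * ‖A x‖ ≤ 1 * ‖A x‖ := by gcongr
      _ = ‖A x‖ := one_mul _
      _ ≤ ‖A‖ * ‖x‖ := A.le_opNorm x
  have h5 : w * ‖x‖ ≤ |w| * ‖x‖ := mul_le_mul_of_nonneg_right (le_abs_self w) (norm_nonneg x)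
  nlinarith [h1, h2, h3, h4, h5]

/-- If a unit `u` of `X →L[ℝ] X` is bounded below by `c > 0`, its inverse has norm `≤ c⁻¹`. -/
private theorem subCritical_inv_norm_le (u : (X →L[ℝ] X)ˣ) {c : ℝ} (hc : 0 < c)
    (h : ∀ x : X, c * ‖x‖ ≤ ‖(↑u : X →L[ℝ] X) x‖) :
    ‖(↑u⁻¹ : X →L[ℝ] X)‖ ≤ c⁻¹ := by
  refine ContinuousLinearMap.opNorm_le_bound _ (inv_nonneg.mpr hc.le) fun y => ?_
  have h1 := h ((↑u⁻¹ : X →L[ℝ] X) y)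
  have h2 : (↑u : X →L[ℝ] X) ((↑u⁻¹ : X →L[ℝ] X) y) = y := by
    rw [← mul_apply_eq_comp, Units.mul_inv, one_apply_eq_self]
  rw [h2] at h1
  calc ‖(↑u⁻¹ : X →L[ℝ] X) y‖ = c⁻¹ * (c * ‖(↑u⁻¹ : X →L[ℝ] X) y‖) :=
        (inv_mul_cancel_left₀ hc.ne' _).symm
    _ ≤ c⁻¹ * ‖y‖ := mul_le_mul_of_nonneg_left h1 (inv_nonneg.mpr hc.le)

variable [CompleteSpace X]

/-- Continuity step: if `t • A − w • K` is a unit for some `0 ≤ t ≤ 1` and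
`|s − t| * ‖A‖ < w − ‖A‖`, then `s • A − w • K` is a unit as well. -/
private theorem subCritical_step (K A : X →L[ℝ] X) (w t s : ℝ)
    (hK : ∀ x : X, ‖K x‖ = ‖x‖) (hA : ‖A‖ < w) (ht0 : 0 ≤ t) (ht1 : t ≤ 1)
    (hst : |s - t| * ‖A‖ < w - ‖A‖) (hu : IsUnit (t • A - w • K)) :
    IsUnit (s • A - w • K) := by
  obtain ⟨u, hu⟩ := hu
  have hc : 0 < w - ‖A‖ := sub_pos.mpr hA
  have hinv : ‖(↑u⁻¹ : X →L[ℝ] X)‖ ≤ (w - ‖A‖)⁻¹ :=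
    subCritical_inv_norm_le u hc (fun x => by
      rw [hu]; exact subCritical_lower_bound K A w t hK ht0 ht1 x)
  refine subCritical_isUnit_of_norm_sub_lt u hc hinv ?_
  have hdiff : s • A - w • K - (↑u : X →L[ℝ] X) = (s - t) • A := by
    rw [hu, sub_sub_sub_cancel_right, ← sub_smul]
  rw [hdiff, norm_smul, Real.norm_eq_abs]
  exact hst

/-- Finite descent: if `A − w • K` is a unit and `‖A‖ / (w − ‖A‖) < N`, then
`(1 − n / N) • A − w • K` is a unit for every `n ≤ N`. -/
private theorem subCritical_descent (K A : X →L[ℝ] X) (w : ℝ) (N : ℕ)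
    (hK : ∀ x : X, ‖K x‖ = ‖x‖) (hA : ‖A‖ < w) (hN : ‖A‖ / (w - ‖A‖) < N)
    (h1 : IsUnit (A - w • K)) :
    ∀ n : ℕ, n ≤ N → IsUnit ((1 - (n : ℝ) / N) • A - w • K) := by
  have hc : 0 < w - ‖A‖ := sub_pos.mpr hA
  have hNpos : (0 : ℝ) < N := lt_of_le_of_lt (div_nonneg (norm_nonneg _) hc.le) hN
  have hstep : 1 / (N : ℝ) * ‖A‖ < w - ‖A‖ := by
    rw [one_div_mul_eq_div, div_lt_iff₀ hNpos]
    rw [div_lt_iff₀ hc] at hN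
    linarith
  intro n
  induction n with
  | zero =>
    intro _
    simpa using h1
  | succ m ih =>
    intro hm
    have hmN : m ≤ N := Nat.le_of_succ_le hm
    have hprev := ih hmN
    have ht0 : 0 ≤ 1 - (m : ℝ) / N := by
      rw [sub_nonneg, div_le_one hNpos]
      exact_mod_cast hmN
    have ht1 : 1 - (m : ℝ) / N ≤ 1 := by
      have : 0 ≤ (m : ℝ) / N := div_nonneg (Nat.cast_nonneg m) hNpos.le
      linarith
    refine subCritical_step K A w (1 - (m : ℝ) / N) _ hK hA ht0 ht1 ?_ hprev
    have hdiff : (1 - ((m + 1 : ℕ) : ℝ) / N) - (1 - (m : ℝ) / N) = -(1 / (N : ℝ)) := by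
      push_cast
      ring
    rw [hdiff, abs_neg, abs_of_pos (one_div_pos.mpr hNpos)]
    exact hstep

/-- **Tool stub `stub_subCriticalMatchingNotSurjective`** (crux stmt-AnomalousDissipation-18627,
line `Sketch`; card `octave-transfer-rpf`, abstract dichotomy, sub-critical half).  If `K` is a
non-surjective isometric embedding of a real Banach space `X`, `A : X →L[ℝ] X`, and `0 < w` with
`‖A‖ < w`, then `A − w • K` is not surjective.  Proof: continuity method — all
`t • A − w • K`, `0 ≤ t ≤ 1`, are bounded below by `w − ‖A‖`; a surjective one is a unit with
inverse of norm `≤ (w − ‖A‖)⁻¹`, and the Neumann series propagates invertibility in steps of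
size `1/N` from `t = 1` down to `t = 0`, where `−(w • K)` would be surjective. -/
theorem stub_subCriticalMatchingNotSurjective :
    ∀ (X : Type) [NormedAddCommGroup X] [NormedSpace ℝ X] [CompleteSpace X]
      (K : X →L[ℝ] X) (A : X →L[ℝ] X) (w : ℝ), 0 < w →
      (∀ x : X, ‖K x‖ = ‖x‖) → ¬ Function.Surjective K →
      ‖A‖ < w →
      ¬ Function.Surjective ((A - w • K : X →L[ℝ] X) : X → X) := by
  intro X _ _ _ K A w hw hK hKns hA hsurj
  have hc : 0 < w - ‖A‖ := sub_pos.mpr hA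
  -- `A − w • K` is injective (bounded below), hence bijective, hence a unit.
  have hinj : Function.Injective ((A - w • K : X →L[ℝ] X) : X → X) := by
    rw [injective_iff_map_eq_zero]
    intro x hx
    have hle := subCritical_lower_bound K A w 1 hK zero_le_one le_rfl x
    rw [one_smul, hx, norm_zero] at hle
    have hnorm : ‖x‖ ≤ 0 := by nlinarith [norm_nonneg x]
    exact norm_le_zero_iff.mp hnorm
  have h1 : IsUnit (A - w • K) :=
    ContinuousLinearMap.isUnit_iff_bijective.mpr ⟨hinj, hsurj⟩
  -- Descend from `t = 1` to `t = 0` in `N` steps.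
  obtain ⟨N, hN⟩ := exists_nat_gt (‖A‖ / (w - ‖A‖))
  have hNpos : (0 : ℝ) < N := lt_of_le_of_lt (div_nonneg (norm_nonneg _) hc.le) hN
  have h0 := subCritical_descent K A w N hK hA hN h1 N le_rfl
  rw [div_self hNpos.ne', sub_self, zero_smul, zero_sub] at h0
  -- `−(w • K)` is a unit, hence surjective, hence `K` is surjective.
  have hsurj0 : Function.Surjective ((-(w • K) : X →L[ℝ] X) : X → X) :=
    (ContinuousLinearMap.isUnit_iff_bijective.mp h0).2
  apply hKns
  intro z
  obtain ⟨x, hx⟩ := hsurj0 (-(w • z))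
  refine ⟨x, ?_⟩
  have hx' : w • K x = w • z := by
    have := hx
    simp only [neg_apply, smul_apply, neg_inj] at this
    exact this
  exact smul_right_injective X hw.ne' hx'

end Summit.AnomalousDissipation.AnomalousDissipation.Theorems.HalfSpaceHierarchy
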